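import Literature.AlgebraicGeometry.Resolution.BlowupsFlatBaseChange
import Literature.AlgebraicGeometry.Resolution.CompletedPullbackRegular
import Literature.RingTheory.Flat.ShortExact
import Mathlib.AlgebraicGeometry.IdealSheaf.Subscheme
import Mathlib.RingTheory.TensorProduct.Basic
import HarnessLib

/-!
# Relative effective Cartier divisors; blow-ups commute with base change when the exceptional divisor is flat over the base

Topic: `Literature/AlgebraicGeometry/Resolution`. A brick for the SPREADING-OUT step of the
large-characteristic resolution statements (`SpreadsShapedFromGenericPoint`,
`CanonicalResolutionSpread.lean`; `SpreadsFromGenericPoint`, `EffectiveResolutionSpread.lean`):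
a sequence of blow-ups constructed over a base `Spec D` has to be SPECIALIZED to the fibres over
the points `Spec k → Spec D`, a base change which is NOT flat, so that
`IsBlowup.of_isPullback_of_flat` (`BlowupsFlatBaseChange.lean`, GW Prop. 13.91 (2)) does not
apply. With blow-ups in the sense of the universal property (`IsBlowup`, `Blowups.lean`,
GW Def. 13.90) the universal property of a base-changed blow-up is FORMAL for every base change;
the only issue is whether the pulled-back exceptional divisor is still an effective Cartier
divisor, and it is as soon as the exceptional divisor is FLAT over the base (a *relative*
effective Cartier divisor: Stacks Project, Section "Relative effective Cartier divisors",
Tag 062T, Lemma 056P (1) "the pullback of a relative effective Cartier divisor along any base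
change is a relative effective Cartier divisor"; EGA IV₄ (21.15.9)). In the application the
flatness of the (finitely many) exceptional divisors over the base is arranged by generic
flatness after shrinking `Spec D`. Everything is PROVED:

* `tmul_one_mem_nonZeroDivisors_of_flat_quotient` — the algebra (Stacks 00HL = Mathlib/tree
  `rTensor_injective_of_exact_of_flat` applied to `0 → R —b→ R → R/(b) → 0`): if `b ∈ R` is a
  non-zero-divisor and `R/(b)` is flat over `D`, then `b ⊗ 1` is a non-zero-divisor of
  `R ⊗_D E` for every `D`-algebra `E`.
* `IsEffectiveCartier.comap_fst_of_flat_subscheme` — **relative effective Cartier divisors are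
  stable under base change** (Stacks 056P (1)): for `q : X → Spec D`, an effective Cartier
  divisor `V(K) ⊆ X` FLAT over `Spec D`, and a cartesian square `P = X ×_{Spec D} Spec E`, the
  pulled-back ideal `K · 𝒪_P` is an effective Cartier divisor (affine charts
  `Spec (Γ(X, W) ⊗_D E)` of the fibre product, `specTensorChart`).
* `IsBlowup.of_isPullback_of_flat_exceptional` — **blow-ups commute with arbitrary affine base
  change when the exceptional divisor is flat over the base**: if `π : X' → X` is a blow-up along
  `J`, `q : X → Spec D`, the exceptional divisor `V(J · 𝒪_{X'})` is flat over `Spec D`, and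
  `X_E = X ×_{Spec D} Spec E`, `P = X' ×_X X_E` (cartesian squares), then `P → X_E` is a blow-up
  along `J · 𝒪_{X_E}`; `IsBlowup.pullback_snd_of_flat_exceptional` — the same for Mathlib's
  chosen fibre products.

## Sources

* The Stacks Project, Tag 062T (Divisors, Section "Relative effective Cartier divisors"),
  Lemma 056P; Tag 00HL (Algebra, Lemma 10.39.12); Tag 0805 (blowing up and base change).
  [StacksProject]
* A. Grothendieck, EGA IV₄ (Publ. Math. IHÉS 32, 1967), (21.15.8)–(21.15.9) (diviseurs relatifs
  et changement de base). [folklore]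
* U. Görtz, T. Wedhorn, *Algebraic Geometry I*, 2nd ed. (2020), Def. 13.90, Prop. 13.91.
  [GortzWedhorn2020]
-/

noncomputable section

open CategoryTheory CategoryTheory.Limits AlgebraicGeometry TopologicalSpace TensorProduct

namespace Literature.AlgebraicGeometry.Resolution

universe u

/-! ## The algebra: `b ⊗ 1` stays a non-zero-divisor when `R/(b)` is flat over the base -/

section Algebra

variable {D : Type*} [CommRing D] {R : Type*} [CommRing R] [Algebra D R]

/-- **A relative non-zero-divisor stays a non-zero-divisor after base change** (Stacks 00HL
applied to `0 → R —b·→ R → R/(b) → 0`; the affine content of Stacks 056P (1) / EGA IV₄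
(21.15.9)): if `b ∈ R` is a non-zero-divisor and `R/(b)` is a flat `D`-module, then `b ⊗ 1` is
a non-zero-divisor of `R ⊗_D E` for every `D`-algebra `E`.
[cite: StacksProject, Tag 00HL (Algebra, Lemma 10.39.12) and Tag 056P] -/
theorem tmul_one_mem_nonZeroDivisors_of_flat_quotient {b : R} (hb : b ∈ nonZeroDivisors R)
    [Module.Flat D (R ⧸ Ideal.span ({b} : Set R))]
    (E : Type*) [CommRing E] [Algebra D E] :
    (b ⊗ₜ[D] (1 : E) : R ⊗[D] E) ∈ nonZeroDivisors (R ⊗[D] E) := by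
  -- the short exact sequence `0 → R —b·→ R → R/(b) → 0` of `D`-modules
  let f : R →ₗ[D] R := LinearMap.mulLeft D b
  let g : R →ₗ[D] R ⧸ Ideal.span ({b} : Set R) :=
    (Ideal.Quotient.mkₐ D (Ideal.span ({b} : Set R))).toLinearMap
  have hf : Function.Injective f := by
    intro x y hxy
    have h : b * x = b * y := hxy
    rw [mul_comm b x, mul_comm b y] at h
    exact (mul_cancel_right_mem_nonZeroDivisors hb).mp h
  have hg : Function.Surjective g := Ideal.Quotient.mk_surjective
  have hfg : Function.Exact f g := by
    intro y
    change Ideal.Quotient.mk (Ideal.span ({b} : Set R)) y = 0 ↔ y ∈ Set.range (fun x => b * x)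
    rw [Ideal.Quotient.eq_zero_iff_mem, Ideal.mem_span_singleton]
    constructor
    · rintro ⟨c, rfl⟩
      exact ⟨c, rfl⟩
    · rintro ⟨c, rfl⟩
      exact ⟨c, rfl⟩
  have hinj : Function.Injective (f.rTensor E) :=
    Literature.RingTheory.Flat.rTensor_injective_of_exact_of_flat hfg hf hg E
  -- `f ⊗ E` is multiplication by `b ⊗ 1`
  have hmul : ∀ x : R ⊗[D] E, f.rTensor E x = (b ⊗ₜ[D] (1 : E)) * x := by
    intro x
    induction x using TensorProduct.induction_on with
    | zero => rw [map_zero, mul_zero]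
    | tmul r e =>
        rw [LinearMap.rTensor_tmul, Algebra.TensorProduct.tmul_mul_tmul, one_mul]
        rfl
    | add x y hx hy => rw [map_add, hx, hy, mul_add]
  rw [mem_nonZeroDivisors_iff_right]
  intro x hx
  apply hinj
  rw [hmul, map_zero, mul_comm]
  exact hx

end Algebra

/-- Non-zero-divisors are detected through a ring isomorphism. [folklore] -/
theorem mem_nonZeroDivisors_of_map_ringEquiv {A B : Type*} [CommRing A] [CommRing B]
    (e : A ≃+* B) {a : A} (h : e a ∈ nonZeroDivisors B) : a ∈ nonZeroDivisors A := by
  rw [mem_nonZeroDivisors_iff_right] at h ⊢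
  intro x hx
  have hx' : e x * e a = 0 := by rw [← map_mul, hx, map_zero]
  exact e.injective ((h _ hx').trans (map_zero e).symm)

/-! ## Relative effective Cartier divisors are stable under base change (Stacks 056P) -/

section RelativeCartier

variable {D : Type u} (E : Type u) [CommRing D] [CommRing E] [Algebra D E] {X : Scheme.{u}}
  (q : X ⟶ Spec (.of D)) {K : X.IdealSheafData}

/-- Sections over an affine open of a closed subscheme flat over `Spec D`: if `V(K) → Spec D` is
flat then `Γ(X, W) ⧸ K(W)` is a flat `D`-module for every affine open `W ⊆ X` (the affine piece
`Spec (Γ(X, W) ⧸ K(W)) ↪ V(K)` of Mathlib's `subschemeCover` is an open immersion). [folklore] -/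
theorem moduleFlat_quotient_of_flat_subschemeι [Flat (K.subschemeι ≫ q)] (W : X.affineOpens)
    [Algebra D Γ(X, W)]
    (hW : W.2.fromSpec ≫ q = Spec.map (CommRingCat.ofHom (algebraMap D Γ(X, W)))) :
    Module.Flat D (Γ(X, W) ⧸ K.ideal W) := by
  have h1 : Flat (K.subschemeCover.f W ≫ K.subschemeι ≫ q) := inferInstance
  have h2 : Flat ((Spec.map (CommRingCat.ofHom (Ideal.Quotient.mk (K.ideal W))) ≫ W.2.fromSpec) ≫
      q) := by
    rwa [← Category.assoc, K.subschemeCover_map_subschemeι W, K.glueDataObjι_ι W] at h1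
  rw [Category.assoc, hW, ← Spec.map_comp, ← CommRingCat.ofHom_comp,
    HasRingHomProperty.Spec_iff (P := @Flat), CommRingCat.hom_ofHom,
    Ideal.Quotient.mk_comp_algebraMap, RingHom.flat_algebraMap_iff] at h2
  exact h2

/-- Sections of `Spec S ⟶ Spec Γ(X, U) ⟶ X` over the affine open `U`: the ring map itself (up
to `Γ(Spec S, ⊤) ≅ S`). [folklore] -/
theorem appLE_top_of_eq_SpecMap_comp_fromSpec {S : CommRingCat.{u}} (U : X.affineOpens)
    (ψ : Γ(X, U) ⟶ S) (g : Spec S ⟶ X) (hg : g = Spec.map ψ ≫ U.2.fromSpec)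
    (h : (⊤ : (Spec S).Opens) ≤ g ⁻¹ᵁ (U : X.Opens)) :
    g.appLE U ⊤ h = ψ ≫ (Scheme.ΓSpecIso S).inv := by
  subst hg
  rw [Scheme.Hom.comp_appLE, IsAffineOpen.fromSpec_app_self, Category.assoc, Scheme.Hom.map_appLE,
    Scheme.ΓSpecIso_inv_naturality]
  rfl

/-- **Relative effective Cartier divisors are stable under base change** (Stacks 056P (1); EGA
IV₄ (21.15.9)), for Mathlib's chosen fibre product: let `q : X → Spec D`, `K` an ideal sheaf on
`X` such that `V(K)` is an effective Cartier divisor which is FLAT over `Spec D`, and `E` a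
`D`-algebra. Then `K · 𝒪` is an effective Cartier divisor on `X ×_{Spec D} Spec E`: over the
affine chart `Spec (Γ(X, W) ⊗_D E)` above an affine open `W` where `K(W) = (b)`, the pulled-back
ideal is generated by `b ⊗ 1`, a non-zero-divisor because `Γ(X, W)/(b)` is `D`-flat
(`tmul_one_mem_nonZeroDivisors_of_flat_quotient`).
[cite: StacksProject, Tag 056P (1) (Divisors, Section 062T)] -/
theorem IsEffectiveCartier.comap_pullback_fst_of_flat_subschemeι (hK : IsEffectiveCartier K)
    [Flat (K.subschemeι ≫ q)] :
    IsEffectiveCartier (K.comap (pullback.fst q (specOfAlgebra D E))) := by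
  intro p
  obtain ⟨W, hxW, b, hb, hKW⟩ := hK (pullback.fst q (specOfAlgebra D E) p)
  -- the affine chart `Spec (Γ(X, W) ⊗_D E)` of the fibre product over `W`
  let iW : Spec Γ(X, W) ⟶ X := W.2.fromSpec
  let φ : CommRingCat.of D ⟶ Γ(X, W) := Spec.preimage (iW ≫ q)
  letI : Algebra D Γ(X, W) := φ.hom.toAlgebra
  have hi : iW ≫ q = Spec.map (CommRingCat.ofHom (algebraMap D Γ(X, W))) := by
    rw [RingHom.algebraMap_toAlgebra, CommRingCat.ofHom_hom, Spec.map_preimage]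
  haveI : Module.Flat D (Γ(X, W) ⧸ K.ideal W) := moduleFlat_quotient_of_flat_subschemeι q W hi
  haveI : Module.Flat D (Γ(X, W) ⧸ Ideal.span ({b} : Set Γ(X, W))) := by rwa [← hKW]
  let c := specTensorChart E q iW hi
  have hcW' : IsAffineOpen (c ''ᵁ ⊤) := (isAffineOpen_top _).image_of_isOpenImmersion c
  have hpW' : p ∈ c ''ᵁ ⊤ := by
    have hp : p ∈ Set.range c := by
      rw [range_specTensorChart]
      show pullback.fst q (specOfAlgebra D E) p ∈ Set.range iW
      rw [IsAffineOpen.range_fromSpec]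
      exact hxW
    obtain ⟨y, hy⟩ := hp
    exact ⟨y, trivial, hy⟩
  have hle : c ''ᵁ ⊤ ≤ pullback.fst q (specOfAlgebra D E) ⁻¹ᵁ (W : X.Opens) := by
    rintro _ ⟨y, -, rfl⟩
    show (c ≫ pullback.fst q (specOfAlgebra D E)) y ∈ (W : X.Opens)
    rw [specTensorChart_fst, Scheme.Hom.comp_apply]
    have hmem := Set.mem_range_self (f := iW)
      (Spec.map (CommRingCat.ofHom (Algebra.TensorProduct.includeLeftRingHom (R := D)
        (A := Γ(X, W)) (B := E))) y)
    rw [IsAffineOpen.range_fromSpec] at hmem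
    exact hmem
  set b' : Γ(pullback q (specOfAlgebra D E), c ''ᵁ ⊤) :=
    (pullback.fst q (specOfAlgebra D E)).appLE W (c ''ᵁ ⊤) hle b with hb'def
  refine ⟨⟨c ''ᵁ ⊤, hcW'⟩, hpW', b', ?_, ?_⟩
  · -- `b'` corresponds to `b ⊗ 1` under `Γ(P, c(Spec (Γ(X,W) ⊗ E))) ≅ Γ(X, W) ⊗_D E`
    let ψ : Γ(X, W) ⟶ CommRingCat.of (Γ(X, W) ⊗[D] E) :=
      CommRingCat.ofHom (Algebra.TensorProduct.includeLeftRingHom (R := D) (A := Γ(X, W)) (B := E))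
    have hcfst : c ≫ pullback.fst q (specOfAlgebra D E) = Spec.map ψ ≫ iW := specTensorChart_fst E q iW hi
    have key : (c.appIso ⊤).hom b' =
        (Scheme.ΓSpecIso (.of (Γ(X, W) ⊗[D] E))).inv (b ⊗ₜ[D] (1 : E)) := by
      rw [hb'def, Scheme.Hom.appIso_hom', ← CommRingCat.comp_apply, Scheme.Hom.appLE_comp_appLE,
        appLE_top_of_eq_SpecMap_comp_fromSpec W ψ _ hcfst, CommRingCat.comp_apply]
      rfl
    let e : Γ(pullback q (specOfAlgebra D E), c ''ᵁ ⊤) ≅ CommRingCat.of (Γ(X, W) ⊗[D] E) :=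
      c.appIso ⊤ ≪≫ Scheme.ΓSpecIso (.of (Γ(X, W) ⊗[D] E))
    refine mem_nonZeroDivisors_of_map_ringEquiv e.commRingCatIsoToRingEquiv ?_
    have he : e.commRingCatIsoToRingEquiv b' = b ⊗ₜ[D] (1 : E) := by
      change (Scheme.ΓSpecIso (.of (Γ(X, W) ⊗[D] E))).hom ((c.appIso ⊤).hom b') = _
      rw [key, ← CommRingCat.comp_apply, Iso.inv_hom_id]
      rfl
    rw [he]
    exact tmul_one_mem_nonZeroDivisors_of_flat_quotient hb E
  · rw [ideal_comap_of_le (pullback.fst q (specOfAlgebra D E)) K W ⟨c ''ᵁ ⊤, hcW'⟩ hle, hKW,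
      Ideal.map_span, Set.image_singleton]

/-- **Relative effective Cartier divisors are stable under base change** (Stacks 056P (1)), for
an arbitrary cartesian square: `q : X → Spec D`, `V(K) ⊆ X` an effective Cartier divisor flat
over `Spec D`, `fst : P → X`, `snd : P → Spec E` with `P ≅ X ×_{Spec D} Spec E`; then
`K · 𝒪_P` is an effective Cartier divisor. [cite: StacksProject, Tag 056P (1)] -/
theorem IsEffectiveCartier.comap_fst_of_flat_subschemeι (hK : IsEffectiveCartier K)
    [Flat (K.subschemeι ≫ q)] {P : Scheme.{u}} {fst : P ⟶ X} {snd : P ⟶ Spec (.of E)}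
    (H : IsPullback fst snd q (specOfAlgebra D E)) : IsEffectiveCartier (K.comap fst) := by
  have h := (hK.comap_pullback_fst_of_flat_subschemeι E q).comap_of_flat H.isoPullback.hom
  rwa [← Scheme.IdealSheafData.comap_comp, H.isoPullback_hom_fst] at h

end RelativeCartier

/-! ## Blow-ups commute with base change when the exceptional divisor is flat over the base -/

section Blowup

variable {D : Type u} (E : Type u) [CommRing D] [CommRing E] [Algebra D E]
  {X' X XE P : Scheme.{u}} {π : X' ⟶ X} {J : X.IdealSheafData} (q : X ⟶ Spec (.of D))

/-- **Blow-ups commute with (affine) base change when the exceptional divisor is flat over the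
base** (Stacks 0805 for flat base change; here: relative effective Cartier divisors, Stacks
056P, EGA IV₄ (21.15.9)): let `π : X' → X` be a blow-up along `J`, `q : X → Spec D` such that
the exceptional divisor `V(J · 𝒪_{X'}) → Spec D` is FLAT, `E` a `D`-algebra,
`X_E = X ×_{Spec D} Spec E` (`ι : X_E → X`) and `P = X' ×_X X_E` (cartesian squares, arbitrary).
Then `P → X_E` is a blow-up of `X_E` along `J · 𝒪_{X_E}`: its universal property is that of `π`
composed with that of the fibre product, and its exceptional divisor — the pull-back of
`V(J · 𝒪_{X'})` along `P → X'`, a base change of `Spec E → Spec D` — is an effective Cartier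
divisor by `IsEffectiveCartier.comap_fst_of_flat_subschemeι`.
[cite: StacksProject, Tag 056P (1) with Tag 0805; GortzWedhorn2020, Def. 13.90] -/
theorem IsBlowup.of_isPullback_of_flat_exceptional (hπ : IsBlowup π J)
    [Flat ((J.comap π).subschemeι ≫ π ≫ q)]
    {ι : XE ⟶ X} {sE : XE ⟶ Spec (.of E)} (HX : IsPullback ι sE q (specOfAlgebra D E))
    {fst : P ⟶ X'} {snd : P ⟶ XE} (H : IsPullback fst snd π ι) :
    IsBlowup snd (J.comap ι) := by
  constructor
  · rw [← Scheme.IdealSheafData.comap_comp, ← H.w, Scheme.IdealSheafData.comap_comp]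
    exact IsEffectiveCartier.comap_fst_of_flat_subschemeι E (π ≫ q) hπ.isEffectiveCartier
      (H.paste_vert HX)
  · intro W a ha
    rw [← Scheme.IdealSheafData.comap_comp] at ha
    obtain ⟨b, hb, hbu⟩ := hπ.universal (a ≫ ι) ha
    refine ⟨H.lift b a hb, H.lift_snd b a hb, fun c hc => ?_⟩
    have hc : c ≫ snd = a := hc
    apply H.hom_ext
    · rw [H.lift_fst]
      exact hbu _ (show (c ≫ fst) ≫ π = a ≫ ι by rw [Category.assoc, H.w, reassoc_of% hc])
    · rw [H.lift_snd, hc]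

/-- **Blow-ups commute with base change when the exceptional divisor is flat over the base**,
for Mathlib's chosen fibre products: with `ι = pullback.fst q (Spec E → Spec D) : X_E → X`,
`pullback.snd π ι : X' ×_X X_E → X_E` is a blow-up along `J · 𝒪_{X_E}`.
[cite: StacksProject, Tag 056P (1) with Tag 0805] -/
theorem IsBlowup.pullback_snd_of_flat_exceptional (hπ : IsBlowup π J)
    [Flat ((J.comap π).subschemeι ≫ π ≫ q)] :
    IsBlowup (pullback.snd π (pullback.fst q (specOfAlgebra D E)))
      (J.comap (pullback.fst q (specOfAlgebra D E))) :=
  hπ.of_isPullback_of_flat_exceptional E q (IsPullback.of_hasPullback q (specOfAlgebra D E))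
    (IsPullback.of_hasPullback π _)

end Blowup

end Literature.AlgebraicGeometry.Resolution

end
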